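import Summits.BirchSwinnertonDyer.Rank1Residual.X2.GreenbergVatsalUnramifiedAway
import Summits.BirchSwinnertonDyer.Rank1Residual.X2.GreenbergVatsalReductionDatum
import Literature.NumberTheory.GaloisRepresentations.TateH2VanishingArchimedean
import Literature.NumberTheory.GaloisRepresentations.ContinuousH1OrderTwo
import HarnessLib

/-!
# `Sel_{p^∞}(E/ℚ_∞)` and `S^{Σ₀}_{E[p^∞]}(ℚ_∞)` differ ONLY at `Σ₀`: the dual link as an
# EQUALITY modulo the printed local theorem at `p` (referee R106.8, nit
# `gvSelmer-SelmerDualData-link`, equality half)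

HONEST FRAMING (cell `b2b-bsdres`, run/shared/lean/b2b/bsd-rank1-residual/, verbatim in every
file): the goal of the cell is to DELETE the COMBINATION-SHAPED residual classes of the
Birch–Swinnerton-Dyer formula for ALL analytic-rank `≤ 1` elliptic curves over `ℚ` — "full BSD
formula for every rank `≤ 1` curve in class `C`" assembled STRICTLY from published theorems — so
that the rank-`≤ 1` remainder becomes exactly the CONSTRUCTION-SHAPED classes, which are TYPED
(missing-input `Prop`s), NOT attempted. This is not "finishing BSD". Sub-cell
`b2b-bsdres-eisenstein-p2` (CLASS-OWNERS row "X2"), gen 10: research route; NO CLAIM BEYOND STATED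
CLASSES; nothing here changes a label. THEOREMS ONLY (no `def`, no named fact, nothing asserted).

WHAT. For a globally minimal elliptic `E/ℚ`, an ODD good prime `p`, the cyclotomic `ℤ_p`-extension
`κ` (`H = ker κ = Gal(ℚ̄/ℚ_∞)`), Greenberg's data `C_p = ker(E[p^∞] → Ẽ)` (gen 9,
`GreenbergVatsalReductionDatum.reductionData`) and any set `Σ₀` of finite places containing the bad
primes:

* §1 **`localKerOver_completion_eq_top_of_odd`** (any number field, any `H`): for odd `p` the
  archimedean local conditions of `Sel_{p^∞}` are vacuous — `H¹(ℝ, ·)` is `2`-torsion: a crossed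
  homomorphism of `{1, c}` with `p`-power-torsion value `m` (`c m = -m`) is the coboundary of
  `-(p^k+1)/2 · m`.
* §2 **`selmerInfty_eq_gvSelmerInfty_inf_of_le`**: 
  `Sel_{p^∞}(E/ℚ_∞) = S^{Σ₀}_{E[p^∞]}(ℚ_∞) ⊓ {Kummer conditions at the places above Σ₀}`
  as `AddSubgroup`s of `H¹(ℚ_∞, E[p^∞])`, GIVEN the inclusion at the prime above `p`
  `hp : greenbergKer(C_p) ≤ localKerOver(ℚ_p)` ("`L_𝔭 ⊆ im κ_𝔭`") as an explicit hypothesis.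
  Ingredients: `⊆` is gen 9 (`selmerInfty_le_gvSelmerInfty_reductionData`, Kummer compatibility of
  Greenberg's datum); `⊇` at good `v ∉ Σ₀ ∪ {p}` is gen 10's kernel theorem
  `GreenbergVatsalUnramifiedAway.conjH1_mem_localKerOver_of_mem_gvSelmerInfty_of_isCyclotomic`
  (GV p. 17 "`G_η/I_η` has profinite order prime to `p`"), at `∞` it is §1, at `Σ₀` it is imposed,
  and at `p` it is `hp`.

WHAT `hp` IS (PRINTED, not proved here, not asserted): Greenberg–Vatsal 2000, p. 26: "In [Gre99],
one can find a proof that `im(κ_𝔭) = L_𝔭`" with `L_𝔭 = ker(H¹((ℚ_∞)_𝔭, A) → H¹(I_𝔭, D))` (p. 16)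
— Greenberg, LNM 1716, Prop. 2.4 ("`Im(κ_K) = Im(λ_K)`" for `K = (F_∞)_η`, p. 74) with Prop. 2.2
and the remark "`E[p^∞]/C_v` is the maximal unramified quotient" (p. 73); good ORDINARY `p`. The
converse inclusion `im κ_𝔭 ⊆ L_𝔭` IS a tree theorem (gen 9,
`GreenbergVatsalSelmerLink.localKerOver_le_greenbergKer` with `reductionData_kummer`). So modulo
that one printed local statement the classical Selmer group of `IwasawaSelmer` (dual `= D.X` of
`CongruentLambdaShift`) and GV's `S^{Σ₀}` (object of the kernel comparison of gens 8–9) are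
identified up to EXACTLY the local conditions at `Σ₀` — whose quotient is GV's `∏_{ℓ∈Σ₀} 𝓗_ℓ`
(Cor. 2.3, Prop. 2.4: `λ^{Σ₀} = λ + Σ_{ℓ∈Σ₀} s_ℓ d_ℓ`), the remaining printed bookkeeping of route G.

References: Greenberg–Vatsal (2000) §2 pp. 16–17, 19, 26; Greenberg, LNM 1716 (1999) §2
pp. 69–75; Serre, *Galois Cohomology*, I §2.4, I §5.1 (`H¹` of a group of order `2`).
-/

noncomputable section

open scoped Classical

universe u

namespace Summit.BirchSwinnertonDyer.Rank1Residual.X2.GreenbergVatsalSelmerEquality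

open NumberField IsDedekindDomain Field Literature.NumberTheory.GaloisRepresentations
  Literature.NumberTheory.EllipticCurves Literature.NumberTheory.EllipticCurves.GreenbergSelmer
  Summit.BirchSwinnertonDyer.Rank1Residual.X2.GreenbergVatsalTorsion
  Summit.BirchSwinnertonDyer.Rank1Residual.X2.GreenbergVatsalReductionDatum
  Summit.BirchSwinnertonDyer.Rank1Residual.X2.GreenbergVatsalUnramifiedAway

/-! ## §1. Odd `p`: the archimedean local conditions are vacuous -/

section Archimedean

variable {K : Type u} [Field K] [NumberField K] (W : WeierstrassCurve K) (p : ℕ) [Fact p.Prime]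

omit [NumberField K] [Fact p.Prime] in
/-- Halving a `p`-power-torsion element for odd `p`: `m = 2 • ((p^k+1)/2 • m)` when `p^k • m = 0`.
[folklore] -/
theorem two_nsmul_half_eq {M : Type*} [AddCommGroup M] (hp : p ≠ 2) (hpp : p.Prime) {m : M} {k : ℕ}
    (hk : p ^ k • m = 0) : 2 • (((p ^ k + 1) / 2) • m) = m := by
  have hodd : Odd (p ^ k) := (hpp.odd_of_ne_two hp).pow
  have heven : 2 * ((p ^ k + 1) / 2) = p ^ k + 1 :=
    Nat.two_mul_div_two_of_even (hodd.add_one)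
  rw [← mul_nsmul', heven, add_nsmul, hk, zero_add, one_nsmul]

omit [NumberField K] in
/-- **For odd `p`, the archimedean local conditions of `Sel_{p^∞}(E/L)` are automatic**: for every
subgroup `H ≤ Γ_K` and every infinite place `w`, `W.localKerOver p H K_w = ⊤`. The local group
`H_{K_w} ≤ Γ_{K_w}` has order `≤ 2` (`natCard_absoluteGaloisGroup_completion_infinitePlace_le_two`);
a crossed homomorphism `f` of it has `c • f(c) = -f(c)`, and for `m = f(c)` of odd order,
`m' = (p^k+1)/2 • m` satisfies `c • (-m') - (-m') = 2 m' = m`, so `f` is the coboundary of `-m'`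
already with `E[p^∞]`-coefficients. Serre, *Galois Cohomology*, I §5.1 (`H¹` of `ℤ/2`).
[cite: SerreGaloisCohomology1997, I §2.4 and I §5.1] -/
theorem localKerOver_completion_eq_top_of_odd (hp : p ≠ 2) (H : Subgroup (absoluteGaloisGroup K))
    (w : InfinitePlace K) : W.localKerOver p H w.Completion = ⊤ := by
  rw [eq_top_iff]
  intro c _
  obtain ⟨f, rfl⟩ := oneCocycleClass_surjective (discreteTopRep H (W.geomPrimaryTorsion p)) c
  rw [GreenbergVatsalSelmerLink.oneCocycleClass_mem_localKerOver_iff]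
  haveI := finite_absoluteGaloisGroup_completion_infinitePlace w
  set L := localSubgroup H w.Completion with hL
  have hL2 : Nat.card L ≤ 2 :=
    (Nat.card_le_card_of_injective L.subtype L.subtype_injective).trans
      (natCard_absoluteGaloisGroup_completion_infinitePlace_le_two w)
  by_cases htriv : ∀ τ : L, τ = 1
  · refine ⟨0, fun τ ↦ ?_⟩
    rw [htriv τ, map_one, contOneCocycles.apply_one, ZeroMemClass.coe_zero, map_zero, smul_zero,
      sub_zero]
  simp only [not_forall] at htriv
  obtain ⟨c, hc⟩ := htriv
  set m : W.geomPrimaryTorsion p := f.1 (resGalSubgroup H w.Completion c) with hm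
  -- `c • m = -m`
  have hcm : (resGalSubgroup H w.Completion c : absoluteGaloisGroup K) • m = -m := by
    have h := f.2 (resGalSubgroup H _ c) (resGalSubgroup H _ c)
    rw [← map_mul, mul_self_eq_one_of_natCard_le_two hL2, map_one, contOneCocycles.apply_one,
      discreteTopRep_ρ_apply, Subgroup.smul_def] at h
    exact eq_neg_of_add_eq_zero_right h.symm
  -- halve `m`
  obtain ⟨k, hk⟩ : ∃ k : ℕ, p ^ k • m = 0 := by
    obtain ⟨k, hk⟩ := (AddCommGroup.mem_primaryComponent).1 m.2
    exact ⟨k, Subtype.ext (by rw [AddSubmonoidClass.coe_nsmul, ZeroMemClass.coe_zero]; exact hk)⟩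
  set m' : W.geomPrimaryTorsion p := ((p ^ k + 1) / 2) • m with hm'
  have h2 : 2 • m' = m := two_nsmul_half_eq p hp Fact.out hk
  have hcm' : (resGalSubgroup H w.Completion c : absoluteGaloisGroup K) • m' = -m' := by
    rw [hm', smul_comm, hcm, smul_neg]
  refine ⟨pointsMap W w.Completion ((-m' : W.geomPrimaryTorsion p) : W.geomPoints), fun τ ↦ ?_⟩
  rcases eq_or_ne τ 1 with rfl | hτ
  · rw [map_one, contOneCocycles.apply_one, ZeroMemClass.coe_zero, map_zero, OneMemClass.coe_one,
      one_smul, sub_self]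
  obtain rfl := eq_of_ne_one_of_natCard_le_two hL2 hτ hc
  rw [← hm, ← pointsMap_smul, ← map_sub, ← resGalSubgroup_apply_coe, ← primaryComponent.coe_smul,
    ← AddSubgroupClass.coe_sub, smul_neg, hcm', neg_neg, sub_neg_eq_add, ← two_nsmul, h2]

end Archimedean

/-! ## §2. The equality over `ℚ_∞^{cyc}` modulo the local statement at `p` -/

section Equality

variable (W : WeierstrassCurve ℚ) [W.IsElliptic] [W.IsGloballyMinimal] (p : ℕ) [Fact p.Prime]
  (κ : ZpExtension ℚ p) (S₀ : Set (HeightOneSpectrum (𝓞 ℚ)))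

/-- **`Sel_{p^∞}(E/ℚ_∞) = S^{Σ₀}_{E[p^∞]}(ℚ_∞) ⊓ (Kummer conditions above `Σ₀`)`, modulo
`L_𝔭 ⊆ im κ_𝔭`.** `E/ℚ` globally minimal, `p` ODD and good (`p ∤ Δ_E`), `κ` the CYCLOTOMIC
`ℤ_p`-extension, `Σ₀ ⊇` the bad primes (every `v ∉ Σ₀`, `v ∤ p` is good: `hS`), Greenberg's data
`reductionData`; hypothesis `hp`: at the place above `p`, Greenberg's condition implies the Kummer
condition (PRINTED: GV 2000 p. 26 "`im(κ_𝔭) = L_𝔭`" ← Greenberg 1999 Props. 2.2, 2.4, good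
ordinary `p`; not proved here). Then the classical Selmer group (`WeierstrassCurve.selmerInfty`,
dual `= D.X` of route G) is EXACTLY the part of `gvSelmerInfty κ E[p^∞] (reductionData) Σ₀`
satisfying the Kummer condition at every place of `ℚ_∞` above `Σ₀`. `⊆`: gen 9; `⊇`: at good
`v ∉ Σ₀ ∪ {p}` by `conjH1_mem_localKerOver_of_mem_gvSelmerInfty_of_isCyclotomic` (GV p. 17 in the
kernel), at `∞` by `localKerOver_completion_eq_top_of_odd`, at `p` by `hp`, at `Σ₀` by fiat.
[cite: GreenbergVatsal2000, §2 pp. 17, 19, 26] [cite: GreenbergLNM1716, §2 pp. 69–75] -/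
theorem selmerInfty_eq_gvSelmerInfty_inf_of_le (hp2 : p ≠ 2)
    (hΔ : ¬ (p : ℤ) ∣ W.minimalDiscriminantInt) (hκ : κ.IsCyclotomic)
    (hS : ∀ v : HeightOneSpectrum (𝓞 ℚ), v ∉ S₀ → ((p : ℕ) : 𝓞 ℚ) ∉ v.asIdeal →
      W.HasGoodReductionAt v)
    (hp : ∀ (v : HeightOneSpectrum (𝓞 ℚ)) (hv : ((p : ℕ) : 𝓞 ℚ) ∈ v.asIdeal),
      (reductionData W p hΔ v hv).greenbergKer κ.kerSubgroup ≤
        W.localKerOver p κ.kerSubgroup (v.adicCompletion ℚ)) :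
    W.selmerInfty κ =
      gvSelmerInfty κ (W.geomPrimaryTorsion p) (reductionData W p hΔ) S₀ ⊓
        ⨅ (v : HeightOneSpectrum (𝓞 ℚ)) (_ : v ∈ S₀) (σ : absoluteGaloisGroup ℚ),
          (W.localKerOver p κ.kerSubgroup (v.adicCompletion ℚ)).comap
            (conjH1 κ.kerSubgroup (W.geomPrimaryTorsion p) σ) := by
  apply le_antisymm
  · refine le_inf (selmerInfty_le_gvSelmerInfty_reductionData W p S₀ κ hΔ hS) ?_
    intro c hc
    have hc' := (WeierstrassCurve.mem_selmerGroupOver_iff W p κ.kerSubgroup c).1 hc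
    simp only [AddSubgroup.mem_iInf, AddSubgroup.mem_comap]
    exact fun v _ σ ↦ hc'.1 v σ
  · intro c hc
    obtain ⟨hgv, hS0⟩ := AddSubgroup.mem_inf.1 hc
    simp only [AddSubgroup.mem_iInf, AddSubgroup.mem_comap] at hS0
    change c ∈ W.selmerGroupOver p κ.kerSubgroup
    rw [WeierstrassCurve.mem_selmerGroupOver_iff]
    refine ⟨fun v σ ↦ ?_, fun w σ ↦ ?_⟩
    · by_cases hvS : v ∈ S₀
      · exact hS0 v hvS σ
      by_cases hpv : ((p : ℕ) : 𝓞 ℚ) ∈ v.asIdeal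
      · exact hp v hpv (((mem_gvSelmer_iff c).1 hgv).2 v hpv σ)
      · exact conjH1_mem_localKerOver_of_mem_gvSelmerInfty_of_isCyclotomic (κ := κ) (v := v)
          (W := W) (p := p) hκ (reductionData W p hΔ) S₀ hgv hvS (hS v hvS hpv) hpv σ
    · rw [localKerOver_completion_eq_top_of_odd W p hp2]
      exact AddSubgroup.mem_top _

/-- **Corollary (primitive at the good places, `Σ₀ = ∅` form is not available since `Σ₀ ⊇ bad`):
membership form.** Under the same hypotheses, a class of `H¹(ℚ_∞, E[p^∞])` lies in
`Sel_{p^∞}(E/ℚ_∞)` iff it lies in `S^{Σ₀}_{E[p^∞]}(ℚ_∞)` and satisfies the Kummer condition at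
every place above `Σ₀`. [cite: GreenbergVatsal2000, §2 pp. 17, 19, 26] -/
theorem mem_selmerInfty_iff_of_le (hp2 : p ≠ 2)
    (hΔ : ¬ (p : ℤ) ∣ W.minimalDiscriminantInt) (hκ : κ.IsCyclotomic)
    (hS : ∀ v : HeightOneSpectrum (𝓞 ℚ), v ∉ S₀ → ((p : ℕ) : 𝓞 ℚ) ∉ v.asIdeal →
      W.HasGoodReductionAt v)
    (hp : ∀ (v : HeightOneSpectrum (𝓞 ℚ)) (hv : ((p : ℕ) : 𝓞 ℚ) ∈ v.asIdeal),
      (reductionData W p hΔ v hv).greenbergKer κ.kerSubgroup ≤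
        W.localKerOver p κ.kerSubgroup (v.adicCompletion ℚ))
    (c : W.subgroupH1 p κ.kerSubgroup) :
    c ∈ W.selmerInfty κ ↔
      c ∈ gvSelmerInfty κ (W.geomPrimaryTorsion p) (reductionData W p hΔ) S₀ ∧
        ∀ v ∈ S₀, ∀ σ : absoluteGaloisGroup ℚ,
          conjH1 κ.kerSubgroup (W.geomPrimaryTorsion p) σ c ∈
            W.localKerOver p κ.kerSubgroup (v.adicCompletion ℚ) := by
  rw [selmerInfty_eq_gvSelmerInfty_inf_of_le W p κ S₀ hp2 hΔ hκ hS hp, AddSubgroup.mem_inf]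
  simp only [AddSubgroup.mem_iInf, AddSubgroup.mem_comap]

end Equality

end Summit.BirchSwinnertonDyer.Rank1Residual.X2.GreenbergVatsalSelmerEquality

end
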